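import Summits.AtomisticToContinuum.HydrodynamicLimit.Theses.AntiMazurCoboundaries
import Literature.Analysis.FluidPDE.InfiniteHardSphereFlow
import Literature.Analysis.FunctionSpaces.PoissonPointProcess

/-!
# Crux-ideate round 2 (ideator 4) — crux stmt-AtomisticToContinuum-14135 `CorrectorPressureDecay`
# Idea `kifer-compactification`: first lemma and the typed transferred statement

First lemma `AlmostStationaryTimeAverage` (exact, finite `N`, any flow / law / bounded observable):
the time average over `[0,T]` of the push-forwards of ANY law is `2s‖f‖/T`-invariant under a further
time shift `s` — the finite-`N` seed of the compactness step (limit points of time-averaged window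
tilts are stationary for the local generator).

Transferred statement `EntropicBoltzmannProperty` (EBP, infinite volume, flow-stationary form; the
weak-stationary form the bridge actually lands on needs a definition request, see the card): every
translation-invariant, stationary state of the infinite dilute hard-sphere dynamics with specific
relative entropy `s` w.r.t. the Gibbs state `G_{z,β,u}` has one-body fast bias per unit volume at most `s`
(for admissible `g`, `|g| ≤ κ`, `g ⊥ 1, v, |v|²` under the standardised Maxwellian).
-/

noncomputable section

open MeasureTheory ProbabilityTheory Set

namespace Summit.AtomisticToContinuum.HydrodynamicLimit.Cruxes.CorrectorPressureDecay.KiferCompactification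

open Literature.MathematicalPhysics.KineticTheory (T3 V3 hsDiameter localGibbsLaw)
open Literature.Analysis.FluidPDE (HardSphereFlow Config InfiniteHardSphereFlow IsHardSphereGibbs
  IsTranslationInvariant superposeIn)
open Literature.Analysis.FunctionSpaces (PointConfig)

open scoped Classical in
/-- FIRST LEMMA (exact, finite `N`). For every hard-sphere flow `Φ` on `𝕋³`, every probability law `μ`
on phase space, every bounded measurable `f`, every window `T > 0` and shift `s ≥ 0`:
`|T⁻¹∫₀ᵀ E_μ[f ∘ Φ_{t+s}] dt − T⁻¹∫₀ᵀ E_μ[f ∘ Φ_t] dt| ≤ 2 s C / T` (`|f| ≤ C`).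
The two time integrals differ by `T⁻¹(∫_T^{T+s} − ∫_0^s)` of a function bounded by `C`.
Applied to `μ = Q*` (the window tilt `e^{A}G_N/Z`) it says the time-averaged tilt `Q̄_T` is
`O(s/T)`-invariant, i.e. `|E_{Q̄_T}[L f]| ≤ 2‖f‖/T` for `f` in the domain of the generator. Stated with the
jointly measurable piecewise flow `good.piecewise (Φ_t) id` (`= Φ_t` on the good set); PROVED in the seat's
`FirstLemma.lean` (`almostStationaryTimeAverage'_holds`, identical statement). -/
def AlmostStationaryTimeAverage : Prop :=
  ∀ (ε : ℝ) (N : ℕ) (Φ : HardSphereFlow (Literature.Analysis.FluidPDE.Torus.geometry (Fin 3)) ε (N + 1))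
    (μ : Measure (Config (N + 1) (Fin 3) T3)), IsProbabilityMeasure μ →
    ∀ (f : Config (N + 1) (Fin 3) T3 → ℝ) (C : ℝ), Measurable f → (∀ z, |f z| ≤ C) →
    ∀ (T s : ℝ), 0 < T → 0 ≤ s →
      |(T⁻¹ * ∫ t in (0 : ℝ)..T, ∫ z, f (Φ.good.piecewise (Φ.flow (t + s)) id z) ∂μ) -
        T⁻¹ * ∫ t in (0 : ℝ)..T, ∫ z, f (Φ.good.piecewise (Φ.flow t) id z) ∂μ| ≤ 2 * s * C / T

/-- The closed phase-space ball of (position-)radius `r` about the origin: `B(0,r) × ℝ³`. -/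
def phaseBall (r : ℝ) : Set (V3 × V3) :=
  Metric.closedBall (0 : V3) r ×ˢ (Set.univ : Set V3)

/-- TRANSFERRED STATEMENT `C⁺` (flow-stationary form) — the ENTROPIC BOLTZMANN PROPERTY of the infinite
dilute hard-sphere dynamics (diameter `1`): for every inverse temperature `β > 0` and drift `u` there is a
low-activity threshold `z₀` and an amplitude `κ > 0` such that for every activity `z < z₀`, every
infinite hard-sphere flow `Φ` (Alexander's two regularity clauses, copied from stmt-0779), every Gibbs state
`G` of parameters `(1, z, β, u)` that `Φ` leaves a.e.-defined, every probability law `μ` on configurations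
that is translation invariant, a.e.-good, STATIONARY under `Φ`, of finite kinetic energy density, and of
specific relative entropy at most `s` per unit volume w.r.t. `G` (asymptotically along the balls `B(0,n+1)`),
and every admissible fast one-body observable `g` (`|g| ≤ κ`, `g ⊥ span(1,v,|v|²)` in `L²(stdGaussian)`):
the one-body fast bias per unit volume is at most `s`,
`|E_μ[Σ_{p ∈ ω ∩ B(0,1)×ℝ³} g(√β (p.2 − u))]| ≤ s · vol(B(0,1))`.
Gibbs states of shifted `(β', u')` are stationary with `s = I(β',u') > 0` and second-order bias `≤ κ·ρ(β',u')`,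
so `κ < κ*` is necessary (the crux's `∃κ`); the ideal gas (`σ = 0`) and `d = 1` rods violate it (product
stationary states with non-Maxwellian velocity law), exactly where the crux is false. -/
def EntropicBoltzmannProperty : Prop :=
  ∀ β : ℝ, 0 < β → ∀ u : V3, ∃ z₀ : ℝ, 0 < z₀ ∧ ∃ κ : ℝ, 0 < κ ∧ ∀ z : ℝ, 0 < z → z < z₀ →
  ∀ Φ : InfiniteHardSphereFlow (Fin 3) 1,
    ((∀ n : ℕ, ∀ᵐ x ∂(volume : Measure (Fin n → V3 × V3)),
        (∀ i j : Fin n, i ≠ j → (1 : ℝ) ≤ ‖(x i).1 - (x j).1‖) →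
          superposeIn (Set.univ : Set V3) x (∅ : PointConfig (V3 × V3)) ∈ Φ.good) ∧
      (∀ ω ∈ Φ.good, ∀ T b : ℝ, ∃ R : ℕ, b ≤ (R : ℝ) ∧ ∀ n : ℕ, R ≤ n →
        PointConfig.restrict (phaseBall n) ω ∈ Φ.good →
          ∀ p ∈ ω, p.1 ∈ Metric.closedBall (0 : V3) b → ∀ t ∈ Set.Icc (0 : ℝ) T,
            Φ.traj ω p t = Φ.traj (PointConfig.restrict (phaseBall n) ω) p t)) →
  ∀ G : Measure (PointConfig (V3 × V3)), IsHardSphereGibbs 1 z β u G → Φ.IsAEDefined G →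
  ∀ μ : Measure (PointConfig (V3 × V3)), IsProbabilityMeasure μ → IsTranslationInvariant μ →
    Φ.IsAEDefined μ → Φ.IsStationary μ →
    ∫⁻ ω, ENNReal.ofReal (∑ᶠ p ∈ ((ω : Set (V3 × V3)) ∩ phaseBall 1), ‖p.2‖ ^ 2) ∂μ < ⊤ →
  ∀ s : ℝ, 0 ≤ s →
    (∀ δ : ℝ, 0 < δ → ∃ n₀ : ℕ, ∀ n : ℕ, n₀ ≤ n →
      InformationTheory.klDiv (μ.map (PointConfig.restrict (phaseBall ((n : ℝ) + 1))))
          (G.map (PointConfig.restrict (phaseBall ((n : ℝ) + 1)))) ≤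
        ENNReal.ofReal ((s + δ) * (volume (Metric.closedBall (0 : V3) ((n : ℝ) + 1))).toReal)) →
  ∀ g : V3 → ℝ, Continuous g → (∀ v, |g v| ≤ κ) →
    (∀ (c₀ c₂ : ℝ) (b : V3), ∫ v, g v * (c₀ + inner ℝ b v + c₂ * ‖v‖ ^ 2) ∂(stdGaussian V3) = 0) →
    |∫ ω, (∑ᶠ p ∈ ((ω : Set (V3 × V3)) ∩ phaseBall 1), g (Real.sqrt β • (p.2 - u))) ∂μ| ≤
      s * (volume (Metric.closedBall (0 : V3) 1)).toReal

/-- Sanity composition target (NOT proved here; it is the line's bridge theorem): the crux follows from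
the entropic Boltzmann property through the landed equivalence `X ↔ KineticFluxLdDecay` (p99142) and
the compactness bridge `EntropicBoltzmannProperty → KineticFluxLdDecay`. Recorded as a `Prop` so that the
skeleton's shape is visible; nothing is asserted. -/
def BridgeTarget : Prop :=
  EntropicBoltzmannProperty →
    Summit.AtomisticToContinuum.HydrodynamicLimit.Theses.AntiMazurCoboundaries.KineticFluxLdDecay

end Summit.AtomisticToContinuum.HydrodynamicLimit.Cruxes.CorrectorPressureDecay.KiferCompactification
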